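import Literature.MathematicalPhysics.QuantumFieldTheory.Balaban1983to89.Node00.TorusCoverCubeMemberPrint
import Literature.MathematicalPhysics.QuantumFieldTheory.Balaban1983to89.Node00.TorusCoverLocalGauge10

/-!
# NODE 00 — THE TORUS→`ℤᵈ` TWIN AT PRINT'S CUBES, FILE P2: the push-down made DATUM-GENERIC, and [6] PROPOSITION 6 ON PRINT'S CLASS (`zdCubP 𝔸 L ρ₀`) ⇒ THE LOCAL
# GAUGE OF [15] (152) ON A GRID CUBE OF THE TORUS with its FOUR letters (`(ιU)^{ιu} = e^{iη_nA}`, `‖A‖`, `‖∇^{η_n}A‖`, `‖∂^{η_n*}∂^{η_n}A‖ ≤ 2r`) — FILES 28b ∕ 34b at the print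
# datum `propCubeP` (repair (R-b) of record, item (b2); nothing landed edited)

Cell `pub-ymgap`, seat `pub-ymgap-dag-n07-e` generation 15 (R141 (C) s3 «torus-vs-box twin», DAG node N07 = [15]; INTENT-36, bus 2026-08-28).  NEW leaf, PROOF kind (no
`def`); CONSUMED BY NAME, nothing modified: FILE P1 `TorusCoverCubeMemberPrint` (`propCubeP`, `cubeIdxP'`, `isPrint_propCubeP`, `cubeExt_subset_box_propCubeP`), 34a∕34b
(`exists_suGauge_letters10_of_gaugedBoundB8`, `codiffCurlA_cover_eq_pdiv`, `sub_e_mem_cubeExt_of_unshift_mem_image`), FILE 28b (`eq_of_cover_eq_of_mem_cubeExt`,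
`add_e_mem_cubeExt_of_shift_mem_image`, `cfgExp_eq_expI`, `zdLift_mem_specialUnitaryUnits`), FILES 25∕26 (`zdLift`, `inAk_zdLift_of_top`, `tol_of_level_pred`), k0-s2-w2's
`CarriersB8CubePrint` (`zdCubP`, `prop6Printed_zdCubP_iff`, `CubeB8.IsPrint.of_dvd`), 33b's letters (`Sect2.codiffCurlA`, `Sect2.bondsDeep`), r15's `cover`, def-R's `cubeEnl`,
def-P11's `Sect2.regionOfSet`, r11's `gaugeU ∕ expI ∕ grad`.  `--kind proof --supports stmt-QuantumFields-20541` (K0⁷).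
[15] = [Balaban1985Variational]; [6] = [Balaban1985RegularSpaces]; [I] = [Balaban1987RG1]; [III] = [Balaban1988Convergent].

WHY.  FILES 28b ∕ 34b push [6] Proposition 6's gauge down to a non-wrapping grid cube of the torus at ONE datum (`propCube`, collar `L`), reading Proposition 6 from
node00-def-cube's FULL member `zdCub`.  The repaired K0⁷ stub 2′ gives Proposition 6 on PRINT's cube class only (`zdCubP 𝔸 L ρ₀`, item (b1)); the push-down itself
never looked at the datum beyond «`□♯ ⊆ 𝔔`» and «`𝔔` has scale `n`».  §1 states it ONCE for an ARBITRARY `CubeB8` datum `c` of scale `c.k = n` whose box contains the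
lifted cube `cubeExt S a 0` of a non-wrapping `S`-cube (`S < 2L^{m+K}`): from `GaugedBoundB8 L η_n (zdLift N U) c r` and the `2π`-window of the `SU(N)` normalisation,
an `SU(N)`-valued torus gauge `u` and an exponent `A` with the four letters of 34c's clause at `2r` on `cubeEnl P S a 0` (FILES 28b ∕ 34b are the instance `c :=
propCube`, `S := LⁿM`).  §2 feeds it from Proposition 6 ON PRINT'S CLASS at the print datum `propCubeP P n hn M ρ hρ a` (a print cube at every `ρ₀ ∣ ρ`), the lift
in the class of the member `cubeIdxP'` exactly as in 28b (`inAk_zdLift_of_top` at `α = L³ε_{n−1}`, all levels projecting into the scale-`(n−1)` level set).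

WHAT IS PROVED (kernel; `P : Params` any torus of record with `d ≥ 2`; NO estimate of Bałaban — Proposition 6 enters as the displayed hypothesis `hG` ∕ `hP6`).
§1 `codiffCurlA_cover_eq_pdiv_of_window` · ★★ `exists_localGauge10_window_of_gaugedBoundB8` (datum- AND window-generic push-down: any `CubeB8` datum of scale `n`, any
   cover-injective step-closed window `X ⊆ 𝔔`; four letters at `2r` on `π(X)`) · ★★ `exists_localGauge10_cube_of_gaugedBoundB8` (the window = the lift of a non-wrapping
   grid cube; FILES 28b ∕ 34b are its instance at `propCube`).
§2 ★★★ `exists_localGauge10_cube_of_prop6P` (`B8.Prop6Printed d L B₁ c₁ (zdCubP (M_N ℂ) L ρ₀ ·)`, `ρ₀ ∣ ρ`, `L ≤ ρ`, the class (1.7)∕(1.9)-Top of `U`, `1 ≤ n ≤ kT + 1`,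
   the non-wrapping grid cube `□ = cubeEnl P (LⁿM) a 0` whose PRINT collar projects into the scale-`(n−1)` level set, print's «7dL²M′α₀ ≤ c₁» and the `2π`-window ⇒
   `∃ u A`, four letters at `2r`, `r = 7dL²B₁M′·L³ε_{n−1}`, `M′ = sideP P M ρ`) · `exists_localGauge_cube_of_prop6P` (the three-letter form, 28b's shape).
HONEST FRAMING: compositions by name; [6] Proposition 6 on print's class at the member is the HYPOTHESIS `hP6` (N05's node — n05-e ∕ k0-s2-w1's γ road aims at it above
threshold; never asserted here); nothing of Bałaban discharged; stub 2′ ∕ N07 ∕ N05 ∕ K0⁷ NOT discharged; counts unmoved (5∕27); one finite T⁴ programme at fixed ε —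
NOT continuum ∕ ℝ⁴ ∕ infinite volume ∕ OS ∕ mass gap ∕ Clay.  No `sorry`, no `def`, no `instance`, no `notation`.
-/

noncomputable section

namespace Literature.MathematicalPhysics.QuantumFieldTheory.Balaban1983to89.Node00

open scoped Matrix.Norms.L2Operator
open Complex (I)
open B7Prop1Explicit (e e_apply)
open B7Prop1Local (InBox)
open B7Prop2Explicit (unitaryUnits mem_unitaryUnits)
open B7Prop2SpecialUnitary (specialUnitaryUnits mem_specialUnitaryUnits)
open B8Ineq132 (InAk)
open B8Eq131Cubes (box tcube bLo bHi)
open B8Eq184Proof (cfgExp)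
open B8Eq146AExpansion (plaqCovDeriv)
open B8Eq143PlaqExpansion (pdiv)
open B15Eq112TorusCover (cover)
open B14DomainGeom (Pt)
open B14.Eq213MaximalDomains (side cubeExt)
open B12RegularSpaces111 (gaugeU expI grad)
open B8LeafModelZd (ZdIdx)

variable {P : Params} {N : ℕ} [NeZero N]

/-! ## §1  ★★ The push-down, datum- and window-generic -/

section PushDown

omit [NeZero N] in
/-- 34b's `codiffCurlA_cover_eq_pdiv` for an ARBITRARY window `X ⊆ ℤᵈ` (34b states it on `cubeExt S a 0`; the proof reads only the agreement `A⟨π z, κ⟩ = A′(z, κ)` on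
`X` and the second-order stencil of the bond inside `X`): 33b's torus letter `Sect2.codiffCurlA η A (π x) μ` IS lit-balaban's `pdiv η 1 (plaqCovDeriv η 1 A′) μ x`.
[cite: Balaban1985RegularSpaces, (1.1)–(1.2) p.76; Balaban1987RG1, (0.1) p.251 (the torus)] -/
theorem codiffCurlA_cover_eq_pdiv_of_window (η : ℝ) {X : Set (Pt P.d)} {A : PBond P 0 → MatA N} {A' : B7Prop1Explicit.Site P.d → Fin P.d → MatA N}
    (hA : ∀ z, z ∈ X → ∀ κ, A ⟨cover P z, κ⟩ = A' z κ) {x : B7Prop1Explicit.Site P.d} {μ : Fin P.d}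
    (hx : x ∈ X) (hxμ : x + e μ ∈ X) (hν : ∀ ν, x + e ν ∈ X ∧ x - e ν ∈ X ∧ x - e ν + e μ ∈ X) :
    Sect2.codiffCurlA η A (cover P x) μ = pdiv η (1 : B7Prop1Explicit.Site P.d → Fin P.d → (MatA N)ˣ) (plaqCovDeriv η 1 A') μ x := by
  rw [pdiv_plaqCovDeriv_one_eq_sum, Sect2.codiffCurlA]
  refine Finset.sum_congr rfl fun ν _ => ?_
  obtain ⟨h1, h2, h3⟩ := hν ν
  rw [← cover_sub_e, Sect2.curlA, Sect2.curlA, grad, grad, grad, grad, ← cover_add_e, ← cover_add_e, ← cover_add_e, ← cover_add_e,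
    plaqCovDeriv_one_apply, plaqCovDeriv_one_apply]
  simp only [sub_add_cancel, hA _ hx, hA _ hxμ, hA _ h1, hA _ h2, hA _ h3, ← Complex.ofReal_inv, Complex.coe_smul]

/-- ★★ **THE PUSH-DOWN OF [6] PROPOSITION 6's GAUGE THROUGH THE COVER, FOR AN ARBITRARY CUBE DATUM AND AN ARBITRARY WINDOW** (`d ≥ 2`).  Data: a `CubeB8` datum `c`
(any ambient `K′, Ω′`) of scale `c.k = n`; a WINDOW `X ⊆ box L c.a c.M c.k` of `ℤᵈ` on which the cover is injective and closed under the unit steps it sees on the torus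
(`π x ± e_κ ∈ π(X) ⇒ x ± e_κ ∈ X` — any box of side at most the period, e.g. the lift `cubeExt S a 0` of a non-wrapping grid cube: FILE 28b ∕ 34b's lemmas); a torus
configuration `U` whose lift carries Proposition 6's conclusion `GaugedBoundB8 L η_n (zdLift N U) c r` (`0 ≤ r`); the `2π`-window of the determinant normalisation.
Conclusion: `∃ u : GaugeTransf P 0 (SU N)`, `∃ A`, on `π(X)`: `(ιU)^{ιu}(b) = expI η_n (A b)` and `‖A b‖ ≤ 2r` on the bonds of `Sect2.regionOfSet P (π X)`, `‖∇^{η_n}_μA_ν‖ ≤ 2r`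
on its derivative quadruples, `‖(∂^{η_n*}∂^{η_n}A)(b)‖ ≤ 2r` on `Sect2.bondsDeep (π X)` — 34a's `SU(N)` gauge `s, Ã` on the box pushed down through the cover, verbatim as in
FILES 28b ∕ 34b (which are the instance `c := propCube`, `X := cubeExt (LⁿM) a 0`).
[cite: Balaban1985Variational, (144)–(152) pp.300–301, Thm 1 (9)–(10) p.279; Balaban1985RegularSpaces, Prop. 6 (1.135)–(1.136) p.99, p.98; Balaban1987RG1, (0.1) p.251] -/
theorem exists_localGauge10_window_of_gaugedBoundB8 (hd : 2 ≤ P.d) {K' : ℕ} {Ω' : ℕ → Set (B7Prop1Explicit.Site P.d)} (c : CubeB8 P.d P.L K' Ω')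
    (U : GaugeField P 0 (SU N)) {n : ℕ} (hk : c.k = n) {r : ℝ} (hr : 0 ≤ r)
    (hG : letI : CStarAlgebra (MatA N) := {}; GaugedBoundB8 P.L (P.eta n) (zdLift N U) c r)
    {X : Set (Pt P.d)} (hinj : ∀ ⦃x⦄, x ∈ X → ∀ ⦃x'⦄, x' ∈ X → cover P x = cover P x' → x = x')
    (hfwd : ∀ ⦃x⦄, x ∈ X → ∀ μ, (cover P x).shift μ ∈ cover P '' X → x + e μ ∈ X)
    (hbwd : ∀ ⦃x⦄, x ∈ X → ∀ ν, (cover P x).unshift ν ∈ cover P '' X → x - e ν ∈ X)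
    (hbox : X ⊆ box P.L c.a c.M c.k)
    (h2π : (2 * boxWidth (bLo P.L c.a c.k 0) (bHi P.L c.a c.M c.k 0) + 1) * (P.eta n * N * (r * ((P.L : ℝ) ^ c.k * P.eta n)⁻¹)) < 2 * Real.pi) :
    ∃ u : GaugeTransf P 0 (SU N), ∃ A : PBond P 0 → MatA N,
      (∀ b ∈ (Sect2.regionOfSet P (cover P '' X)).bonds, gaugeU (fun x => ιSU N (u x)) (fun b' => ιSU N (U b')) b = expI (P.eta n) (A b)) ∧
      (∀ b ∈ (Sect2.regionOfSet P (cover P '' X)).bonds, ‖A b‖ ≤ 2 * r) ∧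
      (∀ q ∈ (Sect2.regionOfSet P (cover P '' X)).dpairs, ‖grad (P.eta n) q.2.1 (fun y => A ⟨y, q.2.2⟩) q.1‖ ≤ 2 * r) ∧
      ∀ b ∈ Sect2.bondsDeep (cover P '' X), ‖Sect2.codiffCurlA (P.eta n) A b.src b.dir‖ ≤ 2 * r := by
  classical
  letI : CStarAlgebra (MatA N) := {}
  have hL : 2 ≤ P.L := P.hL.2
  have hηpos : 0 < P.eta n := B3GkZeroTorusRescaled.eta_pos P n
  set V := zdLift N U with hV
  obtain ⟨s, A', h1, h2, h3, h4⟩ := exists_suGauge_letters10_of_gaugedBoundB8 hd hL c V (zdLift_mem_specialUnitaryUnits U) hηpos hr hG h2π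
  have hscale : (P.L : ℝ) ^ c.k * P.eta n = 1 := by rw [hk]; exact B12Eq115BackgroundPair.pow_mul_eta P n
  simp only [hscale, inv_one, mul_one, one_pow] at h2 h3 h4
  -- push-down through the cover (injective on the window)
  let u : GaugeTransf P 0 (SU N) := fun y =>
    if h : ∃ x, x ∈ X ∧ cover P x = y then s (Classical.choose h) else 1
  let A : PBond P 0 → MatA N := fun b =>
    if h : ∃ x, x ∈ X ∧ cover P x = b.src then A' (Classical.choose h) b.dir else 0
  have hu : ∀ x, x ∈ X → u (cover P x) = s x := by
    intro x hx
    have hex : ∃ x', x' ∈ X ∧ cover P x' = cover P x := ⟨x, hx, rfl⟩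
    simp only [u, dif_pos hex]
    rw [hinj (Classical.choose_spec hex).1 hx (Classical.choose_spec hex).2]
  have hA : ∀ x, x ∈ X → ∀ μ, A ⟨cover P x, μ⟩ = A' x μ := by
    intro x hx μ
    have hex : ∃ x', x' ∈ X ∧ cover P x' = cover P x := ⟨x, hx, rfl⟩
    simp only [A, dif_pos hex]
    rw [hinj (Classical.choose_spec hex).1 hx (Classical.choose_spec hex).2]
  have hlift : ∀ y, y ∈ cover P '' X → ∃ x, x ∈ X ∧ cover P x = y := fun y ⟨x, hx, hxy⟩ => ⟨x, hx, hxy⟩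
  refine ⟨u, A, fun b hb => ?_, fun b hb => ?_, fun q hq => ?_, fun b hb => ?_⟩
  · obtain ⟨x, hx, hxs⟩ := hlift b.src hb.1
    have hx' : x + e b.dir ∈ X := hfwd hx b.dir (by rw [hxs]; exact hb.2)
    have hb' : b = ⟨cover P x, b.dir⟩ := by cases b; simp only at hxs; rw [hxs]
    rw [hb', hA x hx]
    have hgauge := h1 x b.dir (hbox hx) (hbox hx')
    rw [cfgExp_eq_expI] at hgauge
    rw [← hgauge]
    simp only [gaugeU, B7Prop1Explicit.gaugeAct, PBond.tgt, ← cover_add_e, hu x hx, hu (x + e b.dir) hx', hV, zdLift_apply]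
  · obtain ⟨x, hx, hxs⟩ := hlift b.src hb.1
    have hx' : x + e b.dir ∈ X := hfwd hx b.dir (by rw [hxs]; exact hb.2)
    have hb' : b = ⟨cover P x, b.dir⟩ := by cases b; simp only at hxs; rw [hxs]
    rw [hb', hA x hx]
    exact h2 x b.dir (hbox hx) (hbox hx')
  · obtain ⟨hq1, hq2, hq3, -⟩ := hq
    obtain ⟨x, hx, hxs⟩ := hlift q.1 hq1
    have hxμ : x + e q.2.1 ∈ X := hfwd hx q.2.1 (by rw [hxs]; exact hq2)
    have hxν : x + e q.2.2 ∈ X := hfwd hx q.2.2 (by rw [hxs]; exact hq3)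
    rw [grad, ← hxs, ← cover_add_e, hA x hx, hA (x + e q.2.1) hxμ, norm_smul, norm_inv, Complex.norm_real, Real.norm_eq_abs, abs_of_pos hηpos]
    calc (P.eta n)⁻¹ * ‖A' (x + e q.2.1) q.2.2 - A' x q.2.2‖ ≤ (P.eta n)⁻¹ * (2 * (P.eta n * r)) :=
          mul_le_mul_of_nonneg_left (h3 x q.2.1 q.2.2 (hbox hx) (hbox hxμ) (hbox hxν)) (inv_nonneg.2 hηpos.le)
      _ = 2 * r := by field_simp
  · obtain ⟨hb1, hb2, hbν⟩ := hb
    obtain ⟨x, hx, hxs⟩ := hlift b.src hb1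
    have hxμ : x + e b.dir ∈ X := hfwd hx b.dir (by rw [hxs]; exact hb2)
    have hstencil : ∀ ν, x + e ν ∈ X ∧ x - e ν ∈ X ∧ x - e ν + e b.dir ∈ X := by
      intro ν
      obtain ⟨s1, s2, s3, s4⟩ := hbν ν
      have hxν : x + e ν ∈ X := hfwd hx ν (by rw [hxs]; exact s1)
      have hxν' : x - e ν ∈ X := hbwd hx ν (by rw [hxs]; exact s2)
      have hxν'' : x - e ν + e b.dir ∈ X :=
        hfwd hxν' b.dir (by
          rw [cover_sub_e, hxs, ← Site.unshift_shift_comm]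
          exact s4)
      exact ⟨hxν, hxν', hxν''⟩
    have hb' : b = ⟨cover P x, b.dir⟩ := by cases b; simp only at hxs; rw [hxs]
    rw [hb']
    show ‖Sect2.codiffCurlA (P.eta n) A (cover P x) b.dir‖ ≤ 2 * r
    rw [codiffCurlA_cover_eq_pdiv_of_window (P.eta n) hA hx hxμ hstencil]
    exact h4 x b.dir (hbox hx) (hbox hxμ) fun ν => ⟨hbox (hstencil ν).1, hbox (hstencil ν).2.1, hbox (hstencil ν).2.2⟩

/-- ★★ **THE PUSH-DOWN AT A NON-WRAPPING GRID CUBE, FOR AN ARBITRARY CUBE DATUM**: the window `X := cubeExt S a 0` (the lift of `□ = cubeEnl P S a 0`, side `S < 2L^{m+K}`;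
the cover is injective there and unit steps lift — FILE 28b's `eq_of_cover_eq_of_mem_cubeExt`, `add_e_mem_cubeExt_of_shift_mem_image`, 34b's
`sub_e_mem_cubeExt_of_unshift_mem_image`) inside the datum's box, `cubeExt S a 0 ⊆ box L c.a c.M c.k`.  FILES 28b ∕ 34b are its instance `c := propCube`, `S := LⁿM`;
§2 below is the instance `c := propCubeP`. [cite: Balaban1985Variational, (144)–(152) pp.300–301; Balaban1985RegularSpaces, Prop. 6 (1.135)–(1.136) p.99; Balaban1987RG1, (0.1) p.251] -/
theorem exists_localGauge10_cube_of_gaugedBoundB8 (hd : 2 ≤ P.d) {K' : ℕ} {Ω' : ℕ → Set (B7Prop1Explicit.Site P.d)} (c : CubeB8 P.d P.L K' Ω')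
    (U : GaugeField P 0 (SU N)) {n : ℕ} (hk : c.k = n) {r : ℝ} (hr : 0 ≤ r)
    (hG : letI : CStarAlgebra (MatA N) := {}; GaugedBoundB8 P.L (P.eta n) (zdLift N U) c r)
    {S : ℕ} {a : Pt P.d} (hSN : (S : ℤ) < P.sitesPerDir 0) (hbox : cubeExt S a 0 ⊆ box P.L c.a c.M c.k)
    (h2π : (2 * boxWidth (bLo P.L c.a c.k 0) (bHi P.L c.a c.M c.k 0) + 1) * (P.eta n * N * (r * ((P.L : ℝ) ^ c.k * P.eta n)⁻¹)) < 2 * Real.pi) :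
    ∃ u : GaugeTransf P 0 (SU N), ∃ A : PBond P 0 → MatA N,
      (∀ b ∈ (Sect2.regionOfSet P (cubeEnl P S a 0)).bonds, gaugeU (fun x => ιSU N (u x)) (fun b' => ιSU N (U b')) b = expI (P.eta n) (A b)) ∧
      (∀ b ∈ (Sect2.regionOfSet P (cubeEnl P S a 0)).bonds, ‖A b‖ ≤ 2 * r) ∧
      (∀ q ∈ (Sect2.regionOfSet P (cubeEnl P S a 0)).dpairs, ‖grad (P.eta n) q.2.1 (fun y => A ⟨y, q.2.2⟩) q.1‖ ≤ 2 * r) ∧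
      ∀ b ∈ Sect2.bondsDeep (cubeEnl P S a 0), ‖Sect2.codiffCurlA (P.eta n) A b.src b.dir‖ ≤ 2 * r := by
  have e0 : cubeEnl P S a 0 = cover P '' cubeExt S a 0 := by simp only [cubeEnl, Nat.zero_mul, Nat.cast_zero]
  rw [e0]
  exact exists_localGauge10_window_of_gaugedBoundB8 hd c U hk hr hG (fun x hx x' hx' h => eq_of_cover_eq_of_mem_cubeExt hSN.le hx hx' h)
    (fun x hx μ h => add_e_mem_cubeExt_of_shift_mem_image hSN hx h) (fun x hx ν h => sub_e_mem_cubeExt_of_unshift_mem_image hSN hx h) hbox h2π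

end PushDown

/-! ## §2  ★★★ [6] Proposition 6 ON PRINT'S CLASS ⇒ the local gauge with four letters on a grid cube of the torus, at the print datum -/

section PrintCubes

/-- ★★★ **[6] PROPOSITION 6 ON PRINT'S CUBE CLASS AT NODE 00's `ℤᵈ` MEMBER ⇒ THE LOCAL GAUGE OF [15] (152) ON ONE GRID CUBE OF THE TORUS, `SU(N)`-VALUED, WITH FOUR
LETTERS.**  Hypotheses: `d ≥ 2`; the Proposition-6 slot ON PRINT'S CLASS `B8.Prop6Printed d L B₁ c₁ (zdCubP (M_N ℂ) L ρ₀ ·)` over n05-a's whole index (N05's node at the cut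
member — K0⁷ stub 2′'s body; `0 ≤ B₁`); a print big block `ρ ≥ L` with `ρ₀ ∣ ρ`; a torus configuration `U` with `|U(∂p) − 1| < ε_m η_m²` on `Sect2.omegaPlaqsTop Ω Ω₀ m` and
`‖η(D*∂U)(b)‖ < ε_m η_m³` on `Sect2.omegaBondsTop Ω Ω₀ m`, `m ≤ kT`; a scale `1 ≤ n ≤ kT + 1` with `0 < ε_{n−1}`; a grid cube `□ = cubeEnl P (LⁿM) a 0`, non-wrapping
(`LⁿM < 2L^{m+K}`), whose PRINT collar `𝔔̃ = tcube L (cornerP) (sideP) ρ n` projects into the scale-`(n−1)` level set (`Ω₀` if `n = 1`; FILE P1 derives this from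
`Sect2.SeqSeparated` under `11d + 4ρ ≤ M₁`, resp. from the hull under `(11d + 4ρ)·L ≤ M₁`); print's smallness «7dL²M′α₀ ≤ c₁» at `α₀ = L³ε_{n−1}` and the `2π`-window.
Conclusion: `∃ u : GaugeTransf P 0 (SU N)`, `∃ A`: `(ιU)^{ιu}(b) = expI η_n (A b)`, `‖A b‖ ≤ 2r`, `‖∇^{η_n}_μ A_ν‖ ≤ 2r`, `‖(∂^{η_n*}∂^{η_n}A)(b)‖ ≤ 2r` on `□` (bonds ∕ stencils ∕
deep bonds), `r = 7dL²B₁M′·L³ε_{n−1}`, `M′ = sideP P M ρ` ([15] (152) «L^jη|A|, (L^jη)²|∇A|, (L^jη)³|∂^{η*}∂^ηA| < 9dL²B₁Mε₀» in the record's letters).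
[cite: Balaban1985Variational, (144)–(152) pp.300–301, Thm 1 (9)–(10) p.279; Balaban1985RegularSpaces, Prop. 6 (1.135)–(1.136) p.99, p.98] -/
theorem exists_localGauge10_cube_of_prop6P (hd : 2 ≤ P.d) {B₁ c₁ : ℝ} (hB₁ : 0 ≤ B₁) {ρ₀ ρ : ℕ} (hρ₀ : ρ₀ ∣ ρ) (hρ : P.L ≤ ρ)
    (hP6 : letI : CStarAlgebra (MatA N) := {}; B8.Prop6Printed P.d (P.L : ℝ) B₁ c₁ (fun i : ZdIdx P.d P.L => zdCubP (MatA N) P.L ρ₀ i))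
    {Ω : ℕ → Set (Site P 0)} {Ω₀ : Set (Site P 0)} {kT : ℕ} {ε : ℕ → ℝ} (U : GaugeField P 0 (SU N))
    (hP : ∀ m, m ≤ kT → PlaqSmallOn (Sect2.omegaPlaqsTop Ω Ω₀ m) (ε m * P.eta m ^ 2) U)
    (hD : ∀ m, m ≤ kT → Sect2.CoDivSmallOn (Sect2.omegaBondsTop Ω Ω₀ m) (ε m * P.eta m ^ 3) U)
    {n : ℕ} (hn : 1 ≤ n) (hnk : n ≤ kT + 1) (hε : 0 < ε (n - 1)) {M : ℕ} (a : Pt P.d)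
    (hSN : ((side P.L M n : ℕ) : ℤ) < P.sitesPerDir 0)
    (hcollar : cover P '' (cubeIdxP' P n hn M ρ a).Ω 0 ⊆ (if n - 1 = 0 then Ω₀ else Ω (n - 1)))
    (hc₁ : 7 * P.d * (P.L : ℝ) ^ 2 * (propCubeP P n hn M ρ hρ a).M * ((P.L : ℝ) ^ 3 * ε (n - 1)) ≤ c₁)
    (h2π : (2 * boxWidth (bLo P.L (propCubeP P n hn M ρ hρ a).a (propCubeP P n hn M ρ hρ a).k 0)
        (bHi P.L (propCubeP P n hn M ρ hρ a).a (propCubeP P n hn M ρ hρ a).M (propCubeP P n hn M ρ hρ a).k 0) + 1) *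
        (P.eta n * N * (7 * P.d * (P.L : ℝ) ^ 2 * B₁ * (propCubeP P n hn M ρ hρ a).M * ((P.L : ℝ) ^ 3 * ε (n - 1)) *
          ((P.L : ℝ) ^ (propCubeP P n hn M ρ hρ a).k * P.eta n)⁻¹)) < 2 * Real.pi) :
    ∃ u : GaugeTransf P 0 (SU N), ∃ A : PBond P 0 → MatA N,
      (∀ b ∈ (Sect2.regionOfSet P (cubeEnl P (side P.L M n) a 0)).bonds,
          gaugeU (fun x => ιSU N (u x)) (fun b' => ιSU N (U b')) b = expI (P.eta n) (A b)) ∧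
      (∀ b ∈ (Sect2.regionOfSet P (cubeEnl P (side P.L M n) a 0)).bonds,
          ‖A b‖ ≤ 2 * (7 * P.d * (P.L : ℝ) ^ 2 * B₁ * (propCubeP P n hn M ρ hρ a).M * ((P.L : ℝ) ^ 3 * ε (n - 1)))) ∧
      (∀ q ∈ (Sect2.regionOfSet P (cubeEnl P (side P.L M n) a 0)).dpairs,
          ‖grad (P.eta n) q.2.1 (fun y => A ⟨y, q.2.2⟩) q.1‖ ≤ 2 * (7 * P.d * (P.L : ℝ) ^ 2 * B₁ * (propCubeP P n hn M ρ hρ a).M * ((P.L : ℝ) ^ 3 * ε (n - 1)))) ∧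
      ∀ b ∈ Sect2.bondsDeep (cubeEnl P (side P.L M n) a 0),
          ‖Sect2.codiffCurlA (P.eta n) A b.src b.dir‖ ≤ 2 * (7 * P.d * (P.L : ℝ) ^ 2 * B₁ * (propCubeP P n hn M ρ hρ a).M * ((P.L : ℝ) ^ 3 * ε (n - 1))) := by
  letI : CStarAlgebra (MatA N) := {}
  have hηpos : 0 < P.eta n := B3GkZeroTorusRescaled.eta_pos P n
  -- the member, the datum, the lift in the class
  set i : ZdIdx P.d P.L := cubeIdxP' P n hn M ρ a with hi
  set c := propCubeP P n hn M ρ hρ a with hc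
  set α : ℝ := (P.L : ℝ) ^ 3 * ε (n - 1) with hα
  have hαpos : 0 < α := mul_pos (pow_pos (by exact_mod_cast P.L_pos) 3) hε
  have hInAk : InAk P.L i.k i.η α i.Ω (zdLift N U) :=
    inAk_zdLift_of_top U hP hD hηpos (lvl := fun _ => n - 1) (fun j _ => by omega) (fun j _ => hcollar)
      (fun j hj => (tol_of_level_pred P hn hε.le hj).1) (fun j hj => (tol_of_level_pred P hn hε.le hj).2)
  have hVU : ∀ x κ, zdLift N U x κ ∈ unitaryUnits (MatA N) := fun x κ => zdLift_mem_unitaryUnits U x κ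
  -- [6] Proposition 6 ON PRINT'S CLASS at the member and the (print) datum
  have hprint : c.IsPrint ρ₀ := (isPrint_propCubeP P n hn M ρ hρ a).of_dvd hρ₀
  have hG : GaugedBoundB8 P.L i.η (zdLift N U) c (7 * P.d * (P.L : ℝ) ^ 2 * B₁ * c.M * α) :=
    (prop6Printed_zdCubP_iff (fun i : ZdIdx P.d P.L => i) ρ₀ B₁ c₁).1 hP6 i α hαpos ⟨zdLift N U, hVU⟩ hInAk c hprint hc₁
  have hr0 : 0 ≤ 7 * P.d * (P.L : ℝ) ^ 2 * B₁ * c.M * α := by positivity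
  exact exists_localGauge10_cube_of_gaugedBoundB8 hd c U rfl hr0 hG hSN (cubeExt_subset_box_propCubeP P n hn M ρ hρ a) h2π

/-- **THE THREE-LETTER FORM** (FILE 28b's shape at the print datum): the same gauge, forgetting the second-order letter.
[cite: Balaban1985Variational, (144)–(152) pp.300–301; Balaban1985RegularSpaces, Prop. 6 (1.135)–(1.136) p.99, p.98] -/
theorem exists_localGauge_cube_of_prop6P (hd : 2 ≤ P.d) {B₁ c₁ : ℝ} (hB₁ : 0 ≤ B₁) {ρ₀ ρ : ℕ} (hρ₀ : ρ₀ ∣ ρ) (hρ : P.L ≤ ρ)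
    (hP6 : letI : CStarAlgebra (MatA N) := {}; B8.Prop6Printed P.d (P.L : ℝ) B₁ c₁ (fun i : ZdIdx P.d P.L => zdCubP (MatA N) P.L ρ₀ i))
    {Ω : ℕ → Set (Site P 0)} {Ω₀ : Set (Site P 0)} {kT : ℕ} {ε : ℕ → ℝ} (U : GaugeField P 0 (SU N))
    (hP : ∀ m, m ≤ kT → PlaqSmallOn (Sect2.omegaPlaqsTop Ω Ω₀ m) (ε m * P.eta m ^ 2) U)
    (hD : ∀ m, m ≤ kT → Sect2.CoDivSmallOn (Sect2.omegaBondsTop Ω Ω₀ m) (ε m * P.eta m ^ 3) U)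
    {n : ℕ} (hn : 1 ≤ n) (hnk : n ≤ kT + 1) (hε : 0 < ε (n - 1)) {M : ℕ} (a : Pt P.d)
    (hSN : ((side P.L M n : ℕ) : ℤ) < P.sitesPerDir 0)
    (hcollar : cover P '' (cubeIdxP' P n hn M ρ a).Ω 0 ⊆ (if n - 1 = 0 then Ω₀ else Ω (n - 1)))
    (hc₁ : 7 * P.d * (P.L : ℝ) ^ 2 * (propCubeP P n hn M ρ hρ a).M * ((P.L : ℝ) ^ 3 * ε (n - 1)) ≤ c₁)
    (h2π : (2 * boxWidth (bLo P.L (propCubeP P n hn M ρ hρ a).a (propCubeP P n hn M ρ hρ a).k 0)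
        (bHi P.L (propCubeP P n hn M ρ hρ a).a (propCubeP P n hn M ρ hρ a).M (propCubeP P n hn M ρ hρ a).k 0) + 1) *
        (P.eta n * N * (7 * P.d * (P.L : ℝ) ^ 2 * B₁ * (propCubeP P n hn M ρ hρ a).M * ((P.L : ℝ) ^ 3 * ε (n - 1)) *
          ((P.L : ℝ) ^ (propCubeP P n hn M ρ hρ a).k * P.eta n)⁻¹)) < 2 * Real.pi) :
    ∃ u : GaugeTransf P 0 (SU N), ∃ A : PBond P 0 → MatA N,
      (∀ b ∈ (Sect2.regionOfSet P (cubeEnl P (side P.L M n) a 0)).bonds,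
          gaugeU (fun x => ιSU N (u x)) (fun b' => ιSU N (U b')) b = expI (P.eta n) (A b)) ∧
      (∀ b ∈ (Sect2.regionOfSet P (cubeEnl P (side P.L M n) a 0)).bonds,
          ‖A b‖ ≤ 2 * (7 * P.d * (P.L : ℝ) ^ 2 * B₁ * (propCubeP P n hn M ρ hρ a).M * ((P.L : ℝ) ^ 3 * ε (n - 1)))) ∧
      ∀ q ∈ (Sect2.regionOfSet P (cubeEnl P (side P.L M n) a 0)).dpairs,
          ‖grad (P.eta n) q.2.1 (fun y => A ⟨y, q.2.2⟩) q.1‖ ≤ 2 * (7 * P.d * (P.L : ℝ) ^ 2 * B₁ * (propCubeP P n hn M ρ hρ a).M * ((P.L : ℝ) ^ 3 * ε (n - 1))) := by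
  obtain ⟨u, A, h1, h2, h3, -⟩ := exists_localGauge10_cube_of_prop6P hd hB₁ hρ₀ hρ hP6 U hP hD hn hnk hε a hSN hcollar hc₁ h2π
  exact ⟨u, A, h1, h2, h3⟩

end PrintCubes

end Literature.MathematicalPhysics.QuantumFieldTheory.Balaban1983to89.Node00

end
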